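import Summits.QuantumAdvantage.QuantumAdvantage.Theorems.WalkThreeStepFarReadUp

/-!
# Rung (G♯₂) `ThreeStepFreeRungFive` (item stmt-QuantumAdvantage-23286), architecture (U), the FAR-READ LEMMA 5b/6: reduction of
# the far cluster to the far cut and its neighbour (lower side)

Cell qa-qnc0, route OddPrimeWalk, support item stmt-QuantumAdvantage-23286; prover qn-prover-3 g17.

Mirror image of file 5/6 (`WalkThreeStepFarReadUp`) for the lower orientation: `h + 128 ≤ π` and `h` is EXTREMAL downwards —
every cut below `h` reading `π` effectively is constant (`DownMin`).  The cluster is `G = {q ∈ pairSet : q ≤ z}` for the clean zone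
`[z, z+9)` below `π` of file 4/6.  STEP A (`down_stepA`): no member at `ρ_π` strictly above `h + 1` away from `ρ_h`; STEP B
(`down_stepB`): no member at `ρ_h = h + d`, `d ≥ 2` (label `e_h + d + m`, one local bit at `h + 1`); STEP C (`down_pair_eq_zero`):
`fourTerm(hq) + fourTerm(h+1) = 0` at every input.
WHAT THIS IS NOT: the final contradiction (freedom + families) is file 6/6; separation NOT moved.
-/

namespace Summit.QuantumAdvantage.AdviceFreeQNC0.LocalEngine

open Finset Classical

namespace RungU

variable {n : ℕ}

namespace Scene

variable (sc : Scene n)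

/-! ### §1 Lower orientation, step A: no member at `ρ_π` above `h + 1` -/

/-- extremality on the lower side: cuts below `h` reading `π` effectively are constant. -/
def DownMin : Prop := ∀ q : Fin (n + 1), q.val < sc.h → cf sc.S q sc.π ≠ 0 → IsConst sc.S q

/-- members below `h` contribute nothing (lower extremality). -/
theorem fourTerm_eq_zero_of_below (hdown : sc.h + 128 ≤ sc.π) (hmin : sc.DownMin) {q : Fin (n + 1)}
    (hq : q ∈ pairSet sc.S sc.π sc.h) (hbelow : q.val < sc.h) (x : Fin n → Bool) : fourTerm sc.S sc.π sc.h x q = 0 := by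
  have hqπ : q.val ≠ sc.π := by omega
  have hqh : q.val ≠ sc.h := by omega
  exact fourTerm_eq_zero_of_isConst sc.S sc.π sc.h q hqπ hqh (hmin q hbelow (sc.cf_ne_zero_of_mem hq hqπ hqh).1) x

/-- **STEP A (lower side)**: with the cluster sum over `G = {q ∈ pairSet : q ≤ z}` vanishing identically (`z ≤ π − 11`), no member of
`G` sits strictly above `h + 1` away from `ρ_h`. -/
theorem down_stepA (hdown : sc.h + 128 ≤ sc.π) {z : ℕ} (hz : sc.π - 31 ≤ z ∧ z ≤ sc.π - 11)
    (hG : ∀ x : Fin n → Bool, ∑ q ∈ (pairSet sc.S sc.π sc.h).filter (fun q => q.val ≤ z), fourTerm sc.S sc.π sc.h x q = 0)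
    {q : Fin (n + 1)} (hqG : q ∈ (pairSet sc.S sc.π sc.h).filter (fun q => q.val ≤ z)) (hhigh : sc.h + 1 < q.val)
    (hρ : q.val ≠ sc.ρh) : False := by
  rw [Finset.mem_filter] at hqG
  obtain ⟨hq, hqz⟩ := hqG
  have hr := sc.room
  have hh := sc.h_bounds
  have hpos : q.val = sc.ρπ := by
    rcases sc.pos_of_mem_pairSet hq with e | e | e | e | e | e | e | e <;> omega
  have hqπ : q.val ≠ sc.π := by omega
  have hqh : q.val ≠ sc.h := by omega
  obtain ⟨cπ, ch⟩ := sc.cf_ne_zero_of_mem hq hqπ hqh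
  -- the kill: nobody in G reads q
  have hkill : ∀ x : Fin n → Bool, Ten x q.val → c4 sc.S sc.π sc.h x q = false := by
    intro x hx
    have h0 := fourTerm_eq_zero_of_unread' sc.S (k := q.val) (by omega) (by omega) (by omega) (by omega) hG q
      (Finset.mem_filter.mpr ⟨hq, hqz⟩) rfl
      (fun q' hq' => by
        rw [Finset.mem_filter] at hq'
        have hne : q'.val ≠ sc.π := by omega
        by_contra hc
        rcases sc.read_of_mem_ne_πq hq'.1 hne hc with e | e | e <;> omega) hx
    rw [fourTerm_eq_c4 sc.S sc.π sc.h x q hqπ hqh] at h0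
    exact (bt_eq_zero _).mp (eq_zero_of_rotZ _ _ h0)
  -- the line witness
  set P₀ : Finset ℕ := {sc.π - 1, sc.h - 1, q.val - 1} with hP₀
  have memP₀ : ∀ j, j ∈ P₀ ↔ (j = sc.π - 1 ∨ j = sc.h - 1 ∨ j = q.val - 1) := by
    intro j; simp only [hP₀, Finset.mem_insert, Finset.mem_singleton]
  set βB := (if q.val ≤ sc.h + 7 then sc.h + 9 else sc.h + 1) with hβB
  have hβB' : sc.h < βB ∧ βB + 5 < sc.π := by rw [hβB]; split_ifs <;> omega
  obtain ⟨β, hβ, j, hj, hc⟩ := line_witness sc.S sc.πh2 (by omega) (by omega) (by omega) (by omega) q cπ ch P₀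
    (fun j hj => by rw [memP₀] at hj; omega)
    ⟨(memP₀ _).mpr (Or.inl rfl), fun hm => by rw [memP₀] at hm; omega⟩
    ⟨(memP₀ _).mpr (Or.inr (Or.inl rfl)), fun hm => by rw [memP₀] at hm; omega⟩
    0 βB (sc.π + 1) ⟨by omega, by omega⟩ (Or.inr hβB') ⟨by omega, by omega, by omega⟩
    (fun i hi => by
      rw [memP₀] at hi
      refine ⟨by omega, ?_, by omega⟩
      rw [hβB]; split_ifs <;> omega)
  have hten : Ten (indic (P₀ ∪ Ico β (β + j)) : Fin n → Bool) q.val := by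
    apply ten_indic _ (by omega)
    · exact Finset.mem_union_left _ ((memP₀ _).mpr (Or.inr (Or.inr rfl)))
    · rw [Finset.mem_union, memP₀, Finset.mem_Ico, not_or]
      refine ⟨by omega, ?_⟩
      rcases hβ with rfl | rfl | rfl
      · omega
      · rw [hβB]; split_ifs <;> omega
      · omega
  rw [hkill _ hten] at hc
  exact Bool.false_ne_true hc

/-! ### §2 Lower orientation, step B: no member at `ρ_h` above `h + 1` -/

/-- the label of the neighbour above: `lab(h+1) = lab(h)  + 1` under `10` at `h`. -/
theorem lab_succ (x : Fin n → Bool) (hx : Ten x sc.h) (q : Fin (n + 1)) (hq : q.val = sc.h + 1) : lab x q = lab x sc.hq + 1 := by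
  have hh := sc.h_bounds
  unfold lab
  rw [hq, sc.hq_val]
  have e := Coset21.wtPrefix_succ x sc.h (by omega)
  rw [(hx ⟨sc.h, by omega⟩).2 rfl] at e
  simp only [Bool.false_eq_true, if_false, add_zero] at e
  rw [e]
  push_cast
  ring

/-- every member of the lower cluster other than a given `ρ`-member contributes `ζ^{e_h+1}(b • 1)` at inputs with `10` at `h`. -/
theorem down_member_form (hdown : sc.h + 128 ≤ sc.π) (hmin : sc.DownMin) {z : ℕ} (hz : sc.π - 31 ≤ z ∧ z ≤ sc.π - 11)
    (hG : ∀ x : Fin n → Bool, ∑ q ∈ (pairSet sc.S sc.π sc.h).filter (fun q => q.val ≤ z), fourTerm sc.S sc.π sc.h x q = 0)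
    (hself : sc.ρh ≠ sc.h) {x : Fin n → Bool} (hx : Ten x sc.h)
    {q : Fin (n + 1)} (hqG : q ∈ (pairSet sc.S sc.π sc.h).filter (fun q => q.val ≤ z)) (hq : q.val ≠ sc.ρh) :
    ∃ b : Bool, fourTerm sc.S sc.π sc.h x q = rotZ (lab x sc.hq + 1) (bt b) := by
  have hqG' := hqG
  rw [Finset.mem_filter] at hqG
  obtain ⟨hqP, hqz⟩ := hqG
  have hh := sc.h_bounds
  by_cases h1 : q.val = sc.h
  · have e : q = sc.hq := sc.eq_hq_of_val h1
    subst e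
    exact ⟨dlt sc.S sc.π x sc.hq, fourTerm_self sc.S sc.πh2 (by omega) (by omega) hx sc.hq sc.hq_val (sc.cf_hq_h_eq_zero hself)⟩
  · by_cases h2 : q.val = sc.h + 1
    · refine ⟨c4 sc.S sc.π sc.h x q, ?_⟩
      rw [fourTerm_eq_c4 sc.S sc.π sc.h x q (by omega) h1, sc.lab_succ x hx q h2]
    · by_cases h3 : q.val < sc.h
      · exact ⟨false, by rw [sc.fourTerm_eq_zero_of_below hdown hmin hqP h3]; unfold bt; simp [rotZ_map_zero]⟩
      · exfalso
        exact sc.down_stepA hdown hz hG hqG' (by omega) hq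

/-- **STEP B (lower side)**: no member of the cluster sits at `ρ_h` strictly above `h + 1`. -/
theorem down_stepB (hdown : sc.h + 128 ≤ sc.π) (hmin : sc.DownMin) {z : ℕ} (hz : sc.π - 31 ≤ z ∧ z ≤ sc.π - 11)
    (hG : ∀ x : Fin n → Bool, ∑ q ∈ (pairSet sc.S sc.π sc.h).filter (fun q => q.val ≤ z), fourTerm sc.S sc.π sc.h x q = 0)
    {q : Fin (n + 1)} (hqG : q ∈ (pairSet sc.S sc.π sc.h).filter (fun q => q.val ≤ z)) (hhigh : sc.h + 1 < q.val)
    (hρ : q.val = sc.ρh) : False := by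
  have hqG' := hqG
  rw [Finset.mem_filter] at hqG
  obtain ⟨hq, hqz⟩ := hqG
  have hr := sc.room
  have hh := sc.h_bounds
  have hqπ : q.val ≠ sc.π := by omega
  have hqh : q.val ≠ sc.h := by omega
  have hself : sc.ρh ≠ sc.h := by omega
  obtain ⟨cπ, ch⟩ := sc.cf_ne_zero_of_mem hq hqπ hqh
  -- the local bit making the label exponent ≢ 1
  set d := q.val - sc.h with hd
  set m₀ := (if d % 3 = 1 then 1 else 0) with hm₀
  have hm₀le : m₀ ≤ 1 := by rw [hm₀]; split_ifs <;> omega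
  have hgood : (d + m₀) % 3 ≠ 1 := by rw [hm₀]; split_ifs with hc <;> omega
  set P₀ : Finset ℕ := ({sc.π - 1, sc.h - 1} : Finset ℕ) ∪ Ico (sc.h + 1) (sc.h + 1 + m₀) with hP₀
  have memP₀ : ∀ j, j ∈ P₀ ↔ (j = sc.π - 1 ∨ j = sc.h - 1 ∨ (sc.h + 1 ≤ j ∧ j < sc.h + 1 + m₀)) := by
    intro j; simp only [hP₀, Finset.mem_union, Finset.mem_insert, Finset.mem_singleton, Finset.mem_Ico, or_assoc]
  have hP₀n : ∀ j ∈ P₀, j < n := fun j hj => by rw [memP₀] at hj; omega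
  -- prefix counts of the base set at h and at ρh
  have base_h : (P₀.filter fun j => j < sc.h).card = 1 := by
    have : (P₀.filter fun j => j < sc.h) = {sc.h - 1} := by
      ext j; rw [Finset.mem_filter, memP₀, Finset.mem_singleton]; omega
    rw [this, Finset.card_singleton]
  have base_ρ : (P₀.filter fun j => j < q.val).card = 1 + m₀ := by
    have : (P₀.filter fun j => j < q.val) = ({sc.h - 1} : Finset ℕ) ∪ Ico (sc.h + 1) (sc.h + 1 + m₀) := by
      ext j; rw [Finset.mem_filter, memP₀, Finset.mem_union, Finset.mem_singleton, Finset.mem_Ico]; omega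
    rw [this, Finset.card_union_of_disjoint, Finset.card_singleton, Nat.card_Ico]
    · omega
    · rw [Finset.disjoint_left]; intro j hj1 hj2
      rw [Finset.mem_singleton] at hj1; rw [Finset.mem_Ico] at hj2; omega
  -- the kill at every admissible witness input
  have hkill : ∀ β j : ℕ, (β = 0 ∨ β = q.val + 1 ∨ β = sc.π + 1) → j < 5 →
      c4 sc.S sc.π sc.h (indic (P₀ ∪ Ico β (β + j)) : Fin n → Bool) q = false := by
    intro β j hβ hj
    set P := P₀ ∪ Ico β (β + j) with hP
    have hPn : ∀ i ∈ P, i < n := by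
      intro i hi; rw [hP, Finset.mem_union, Finset.mem_Ico] at hi
      rcases hi with hi | hi
      · exact hP₀n i hi
      · rcases hβ with rfl | rfl | rfl <;> omega
    have hdis : ∀ i ∈ P₀, ¬ (β ≤ i ∧ i < β + j) := by
      intro i hi; rw [memP₀] at hi; rcases hβ with rfl | rfl | rfl <;> omega
    have tenh : Ten (indic P : Fin n → Bool) sc.h := by
      apply ten_indic _ (by omega)
      · rw [hP]; exact Finset.mem_union_left _ ((memP₀ _).mpr (Or.inr (Or.inl rfl)))
      · rw [hP, Finset.mem_union, memP₀, Finset.mem_Ico, not_or]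
        refine ⟨by omega, ?_⟩; rcases hβ with rfl | rfl | rfl <;> omega
    -- the cluster sum, split off the ρ-member
    have hsum := hG (indic P)
    rw [← Finset.add_sum_erase _ _ hqG'] at hsum
    obtain ⟨B, hB⟩ := sum_rotZ_bt (((pairSet sc.S sc.π sc.h).filter fun q => q.val ≤ z).erase q)
      (fourTerm sc.S sc.π sc.h (indic P)) (lab (indic P : Fin n → Bool) sc.hq + 1)
      (fun q' hq' => sc.down_member_form hdown hmin hz hG hself tenh (Finset.mem_of_mem_erase hq')
        (fun e => Finset.ne_of_mem_erase hq' (Fin.ext (e.trans hρ.symm))))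
    rw [hB, fourTerm_eq_c4 sc.S sc.π sc.h _ q hqπ hqh] at hsum
    -- the two labels
    have hlab : lab (indic P : Fin n → Bool) q = lab (indic P : Fin n → Bool) sc.hq + ((d + m₀ : ℕ) : ZMod 3) := by
      rw [lab_indic P hPn, lab_indic P hPn, sc.hq_val]
      have e1 : (P.filter fun i => i < sc.h).card = 1 + (min (β + j) sc.h - β) := by
        rw [hP, card_lt_union _ _ (Finset.disjoint_left.mpr fun i hi hI => hdis i hi (Finset.mem_Ico.mp hI)), base_h, card_lt_Ico]
      have e2 : (P.filter fun i => i < q.val).card = 1 + m₀ + (min (β + j) q.val - β) := by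
        rw [hP, card_lt_union _ _ (Finset.disjoint_left.mpr fun i hi hI => hdis i hi (Finset.mem_Ico.mp hI)), base_ρ, card_lt_Ico]
      have e3 : min (β + j) sc.h - β = min (β + j) q.val - β := by
        rcases hβ with rfl | rfl | rfl
        · rw [block_below 0 j sc.h (by omega), block_below 0 j q.val (by omega)]
        · rw [block_above _ j sc.h (by omega), block_above _ j q.val (by omega)]
        · rw [block_above _ j sc.h (by omega), block_above _ j q.val (by omega)]
      rw [e1, e2, e3]
      have : q.val + (1 + m₀ + (min (β + j) q.val - β)) = sc.h + (1 + (min (β + j) q.val - β)) + (d + m₀) := by omega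
      rw [this]; push_cast; ring
    rw [hlab, ← rotZ_rotZ, ← rotZ_rotZ, ← rotZ_map_add] at hsum
    have h0 := eq_zero_of_rotZ _ _ hsum
    have h1 : rotZ 1 (bt B) + rotZ ((d + m₀ : ℕ) : ZMod 3) (bt (c4 sc.S sc.π sc.h (indic P) q)) = 0 := by
      rw [add_comm]; exact h0
    exact kill_of_ne_one B _ _ (cast_ne_one hgood) h1
  -- the line witness contradicts the kill
  obtain ⟨β, hβ, j, hj, hc⟩ := line_witness sc.S sc.πh2 (by omega) (by omega) (by omega) (by omega) q cπ ch P₀ hP₀n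
    ⟨(memP₀ _).mpr (Or.inl rfl), fun hm => by rw [memP₀] at hm; omega⟩
    ⟨(memP₀ _).mpr (Or.inr (Or.inl rfl)), fun hm => by rw [memP₀] at hm; omega⟩
    0 (q.val + 1) (sc.π + 1) ⟨by omega, by omega⟩ (Or.inr ⟨by omega, by omega⟩) ⟨by omega, by omega, by omega⟩
    (fun i hi => by rw [memP₀] at hi; refine ⟨by omega, by omega, by omega⟩)
  rw [hkill β j hβ hj] at hc
  exact Bool.false_ne_true hc

/-! ### §3 Lower orientation, step C: the cluster is the far cut and its upper neighbour -/

/-- the upper neighbour of the far cut. -/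
def qup : Fin (n + 1) := ⟨sc.h + 1, by have := sc.h_bounds; omega⟩

/-- its position. -/
theorem qup_val : sc.qup.val = sc.h + 1 := rfl

/-- **STEP C (lower side)**: `fourTerm(hq) + fourTerm(h+1) = 0` at every input. -/
theorem down_pair_eq_zero (hdown : sc.h + 128 ≤ sc.π) (hmin : sc.DownMin) (x : Fin n → Bool) :
    fourTerm sc.S sc.π sc.h x sc.hq + fourTerm sc.S sc.π sc.h x sc.qup = 0 := by
  obtain ⟨z, hz1, hz2, hzρ, hzπ, hG⟩ := sc.far_sum_eq_zero_down hdown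
  have hh := sc.h_bounds
  have hr := sc.room
  set G := (pairSet sc.S sc.π sc.h).filter (fun q => q.val ≤ z) with hGdef
  have hzero : ∀ q ∈ G, q ≠ sc.hq → q ≠ sc.qup → fourTerm sc.S sc.π sc.h x q = 0 := by
    intro q hqG h1 h2
    have hqG' := hqG
    rw [hGdef, Finset.mem_filter] at hqG
    have hv1 : q.val ≠ sc.h := fun e => h1 (sc.eq_hq_of_val e)
    have hv2 : q.val ≠ sc.h + 1 := fun e => h2 (Fin.ext (by rw [qup_val]; exact e))
    by_cases hbelow : q.val < sc.h
    · exact sc.fourTerm_eq_zero_of_below hdown hmin hqG.1 hbelow x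
    · exfalso
      by_cases hρ : q.val = sc.ρh
      · exact sc.down_stepB hdown hmin ⟨hz1, hz2⟩ hG hqG' (by omega) hρ
      · exact sc.down_stepA hdown ⟨hz1, hz2⟩ hG hqG' (by omega) hρ
  have hsum := hG x
  have hhqG : sc.hq ∈ G := by rw [hGdef, Finset.mem_filter]; exact ⟨sc.hq_mem, by rw [sc.hq_val]; omega⟩
  rw [← Finset.add_sum_erase _ _ hhqG] at hsum
  by_cases hup' : sc.qup ∈ G
  · have hup'' : sc.qup ∈ G.erase sc.hq := by
      rw [Finset.mem_erase]; refine ⟨fun e => ?_, hup'⟩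
      have := congrArg Fin.val e; rw [qup_val, sc.hq_val] at this; omega
    rw [← Finset.add_sum_erase _ _ hup''] at hsum
    have : ∑ q ∈ (G.erase sc.hq).erase sc.qup, fourTerm sc.S sc.π sc.h x q = 0 :=
      Finset.sum_eq_zero fun q hq => hzero q (Finset.mem_of_mem_erase (Finset.mem_of_mem_erase hq))
        (Finset.ne_of_mem_erase (Finset.mem_of_mem_erase hq)) (Finset.ne_of_mem_erase hq)
    rw [this, add_zero] at hsum
    exact hsum
  · have hnot : sc.qup ∉ pairSet sc.S sc.π sc.h := by
      intro hm; apply hup'; rw [hGdef, Finset.mem_filter]; exact ⟨hm, by rw [qup_val]; omega⟩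
    have : ∑ q ∈ G.erase sc.hq, fourTerm sc.S sc.π sc.h x q = 0 :=
      Finset.sum_eq_zero fun q hq => hzero q (Finset.mem_of_mem_erase hq) (Finset.ne_of_mem_erase hq)
        (fun e => hup' (e ▸ Finset.mem_of_mem_erase hq))
    rw [this, add_zero] at hsum
    rw [hsum, fourTerm_eq_zero_of_not_mem sc.S sc.πh2 x sc.qup hnot, add_zero]

end Scene

end RungU

end Summit.QuantumAdvantage.AdviceFreeQNC0.LocalEngine
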